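import Literature.AlgebraicGeometry.Motives.AbelianVarietyLatticeTensor
import Literature.AlgebraicGeometry.Motives.AbelianVarietyInducedActionIsotypical
import HarnessLib

/-!
# Induced lattices: `Y ⊗ Ind_H^G N = Ind_H^G (Y ⊗ N)` — a lattice tensor with BLOCK-MONOMIAL matrices over a `G`-set `T` is a
# system of imprimitivity whose stabiliser summand is the lattice tensor of the diagonal block; hence
# `|H| · Tr(ρ(g) | T_ℓ) = Σ_{x : x⁻¹gx ∈ H} tr n(x⁻¹gx) · 2 dim Y`, `|H| · dim B_G(Y ⊗ Ind N) = (Σ_{h ∈ H} tr n(h)) · dim Y`,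
# `|H| · dim B_W(Y ⊗ Ind N) = (Σ_{h ∈ H} c_W(h) tr n(h)) · dim Y`

The bridge between `Motives/AbelianVarietyLatticeTensor` (gen. 33) and the induced actions `Ind_H^G` of
`Motives/AbelianVarietyInducedAction*` (gen. 32).  A `ℤ[G]`-lattice INDUCED from a `ℤ[H]`-lattice `N = (ℤ^κ, n)`, `H = Stab(t₀)` for a
transitive `G`-set `T`, is `M = Ind_H^G N = ⊕_{t ∈ T} N_t` with `g N_t = N_{gt}`: in a basis adapted to `T × κ` its matrices are
BLOCK-MONOMIAL — the `(u, t)` block `A(g)_{u,t} ∈ M_κ(ℤ)` vanishes unless `u = g t` — and the diagonal block of `h ∈ H` at `t₀` is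
`n(h)` (Serre §3.3: "`ρ_s W_σ = W_{sσ}`"; §7.1 Prop. 19).  In the def-free language of the tree the tensor `X = Y ⊗ M` is then the
two-level object: a bicone `c` over `(X₀)_{t ∈ T}` whose summand `X₀ = b.pt = Y ⊗ ℤ^κ` is a power of `Y` (bicone `b` over `κ`), with an
action `ρ` on `c.pt` whose two-level blocks are **`ι_j (ι_t ρ(g) π_u) π_i = A(g)_{u,t,ij} • β(g)`** (`hρ`) for a block-monomial `A`
(`hA : g t ≠ u ⇒ A(g)_{u,t} = 0`).  This file proves (no definitions):

* §1 **`Y ⊗ Ind_H^G N` IS A SYSTEM OF IMPRIMITIVITY**: `g t ≠ u ⇒ ι_t ≫ ρ(g) ≫ π_u = 0` — literally the hypothesis `hρ` of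
  `Motives/AbelianVarietyInducedAction` for `(c, ρ)` (`imprimitive_of_blockMonomial`), so Serre's Thm. 12, Frobenius reciprocity,
  Mackey, … of gen. 32 apply to `Y ⊗ Ind N`; and **THE STABILISER SUMMAND IS THE LATTICE TENSOR `Y ⊗ N`**: the stabiliser action
  `α(h) = ι_{t₀} ρ(h) π_{t₀}` on `X₀ = Y^κ` has blocks `ι_j α(h) π_i = n(h)_{ij} • β(h)` for `n(h) = A(h)_{t₀,t₀}` (`stabilizerAction_blocks`)
  — "`Y ⊗ Ind_H^G N = Ind_H^G (Y ⊗ N)`" (MRS Prop. 4.1 `𝒪[G] ⊗_𝒪 V ≅ Res V` is the case `H = 1`, `N = 𝒪`);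
* §2 consequences for `T` transitive, `G` finite, untwisted inner level (`β = 1`): **`dim (Y ⊗ Ind N) = [G : H] · |κ| · dim Y`**;
  Serre's Thm. 12 for lattices **`|H| · Tr(ρ(g) | T_ℓ(Y ⊗ Ind N)) = Σ_{x ∈ G, (x⁻¹gx) t₀ = t₀} tr A(x⁻¹ g x)_{t₀,t₀} · 2 dim Y`**
  (`card_stabilizer_mul_trace_tateModuleMap_asHom_eq_sum`); **`|H| · dim B_G(Y ⊗ Ind_H^G N) = (Σ_{h ∈ H} tr n(h)) · dim Y`**
  (`card_stabilizer_mul_dim_image_normG_eq`: "`(Ind W)^G = W^H`" and the prequel's `|H| dim B_H(Y ⊗ N) = (Σ_h tr n(h)) dim Y`), i.e.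
  `dim B_G = rank(N^H) · dim Y`; and for every isotypical component **`|H| · dim B_W(Y ⊗ Ind_H^G N) = (Σ_{h ∈ H} c_W(h) tr n(h)) · dim Y`**
  (`card_stabilizer_mul_dim_isotypical_eq`; Frobenius reciprocity `⟨e_W, Ind χ_N⟩_G = ⟨Res e_W, χ_N⟩_H`).

* §3 the rank-one case without the two-level detour: a lattice tensor over a `G`-set `T` with MONOMIAL matrices (`m(g)_{u,t} = 0`
  unless `u = g t`) satisfies `hρ` of `Motives/AbelianVarietyInducedAction` directly (`imprimitive_of_monomial`), the diagonal entry
  `h ↦ m(h)_{t₀t₀}` is a character `ε : Stab(t₀) → ℤˣ` (`exists_stabilizerChar_of_monomial`), and `ι_{t₀} ρ(h) π_{t₀} = ε(h) • 𝟙`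
  (`transfer_eq_units_smul_of_monomial`) — the defining hypotheses of `Motives/AbelianVarietyMonomialAction`:
  `Y ⊗ Ind_H^G ℤ(ε) = Ind_H^G(ε ⊗ Y)`.

Scope (stated, not hidden).  `T` finite and transitive where stabilisers occur, `G` finite in §2, any field `K`; the two-level
description is the INPUT (a user with a flat bicone over `T × κ` first passes to the two-level one); the twist `β` is allowed in §1
and taken trivial in §2.

## References

* [SerreLinearRepresentations1977] J.-P. Serre, *Linear Representations of Finite Groups*, GTM 42 (1977): §3.3 (induced
  representations: "`V = ⊕_{σ ∈ G/H} W_σ`, `ρ_s W_σ = W_{sσ}`"; Thm. 12, the character of `Ind`), §7.1 Prop. 19, §7.2 Thm. 13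
  (Frobenius reciprocity).  Held: `book:serre1977-linear-representations-finite-groups`, PDF pp. 30–31, 50–53.
* [MazurRubinSilverberg2007] B. Mazur, K. Rubin, A. Silverberg, *Twisting commutative algebraic groups*, J. Algebra 314 (2007)
  419–438: Def. 1.1, Prop. 4.1 (`𝒪[G] ⊗_𝒪 V ≅ Res^L_k V`), Thm. 2.1 (i), Def. 4.3 / Thm. 4.5.  Held:
  `paper:doi-10-1016-j-jalgebra-2007-02-052`, PDF pp. 5–6, 9–10.
* [LangeRodriguez2022] H. Lange, R. E. Rodríguez, *Decomposition of Jacobians by Prym Varieties*, LNM 2310 (2022), §2.9.1 Prop. 2.9.3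
  (PDF p. 46), §3.5 (induced actions for intermediate covers).
* [KaniRosen1989] E. Kani, M. Rosen, *Idempotent relations and factors of Jacobians*, Math. Ann. 284 (1989), §3 Thm. B.
* [MumfordAV1970] D. Mumford, *Abelian Varieties* (1970), §19 Thm. 3 (p. 176), Thm. 4 (p. 180).
-/

noncomputable section

open CategoryTheory CategoryTheory.Limits MulAction
open Literature.NumberTheory.DiophantineGeometry
open Literature.RepresentationTheory.FiniteGroups

universe u

namespace Literature.AlgebraicGeometry.Motives

namespace AbelianVariety

namespace LatticeTensor

variable {K : Type u} [Field K]

/-! ## §1 Block-monomial lattices are systems of imprimitivity; the stabiliser summand is `Y ⊗ N` -/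

section Imprimitive

variable {Y : AbelianVariety K} {κ T : Type} [Fintype κ] [Fintype T] [DecidableEq κ]
  (b : Bicone (fun _ : κ ↦ Y)) (c : Bicone (fun _ : T ↦ b.pt)) {G : Type} [Group G] [MulAction G T]
  (A : G → T → T → Matrix κ κ ℤ) (β : G →* End Y) (ρ : G →* End c.pt)

omit [Fintype T] [DecidableEq κ] in
/-- **`Y ⊗ Ind_H^G N` is a system of imprimitivity**: if the two-level blocks of `ρ(g)` are `A(g)_{u,t,ij} • β(g)` with `A(g)_{u,t} = 0`
unless `u = g t` (a block-monomial lattice over the `G`-set `T`), then **`g t ≠ u ⇒ ι_t ≫ ρ(g) ≫ π_u = 0`** — the hypothesis `hρ` of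
`Motives/AbelianVarietyInducedAction` for the bicone `c` over `(Y ⊗ ℤ^κ)_{t ∈ T}` ("`ρ_s W_σ = W_{sσ}`": `ρ(g)` maps the summand
`(Y ⊗ N)_t` into `(Y ⊗ N)_{gt}`). [cite: SerreLinearRepresentations1977, §3.3 Definition and §7.1 Prop. 19] [cite: MazurRubinSilverberg2007, Prop. 4.1] -/
theorem imprimitive_of_blockMonomial (hb : ∑ j, b.π j ≫ b.ι j = 𝟙 b.pt)
    (hρ : ∀ (g : G) (u t : T) (i j : κ),
      b.ι j ≫ (c.ι t ≫ End.asHom (ρ g) ≫ c.π u) ≫ b.π i = A g u t i j • End.asHom (β g))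
    (hA : ∀ (g : G) (u t : T), g • t ≠ u → A g u t = 0) (g : G) (t u : T) (htu : g • t ≠ u) :
    c.ι t ≫ End.asHom (ρ g) ≫ c.π u = 0 := by
  refine hom_ext_of_blocks b b hb hb (P := (0 : Matrix κ κ ℤ)) (φ := End.asHom (β g)) (fun i j ↦ ?_) (fun i j ↦ ?_)
  · rw [hρ g u t i j, hA g u t htu]
  · rw [zero_comp, comp_zero, Matrix.zero_apply, zero_smul]

omit [Fintype κ] [Fintype T] [DecidableEq κ] in
/-- **The stabiliser summand of `Y ⊗ Ind_H^G N` is the lattice tensor `Y ⊗_β N`**: for the stabiliser action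
`α(h) = ι_{t₀} ρ(h) π_{t₀}` of `H = Stab(t₀)` on the summand `X₀ = Y^κ` (`Motives/AbelianVarietyInducedAction`, `exists_stabilizerAction`)
and `n(h) = A(h)_{t₀,t₀}` the diagonal block, **`ι_j ≫ α(h) ≫ π_i = n(h)_{ij} • β(h)`** — the hypothesis `hρ` of
`Motives/AbelianVarietyLatticeTensor` for `(b, n, β|_H, α)`: `Y ⊗ Ind_H^G N = Ind_H^G (Y ⊗ N)`.
[cite: SerreLinearRepresentations1977, §3.3 (the representation `θ` of `H` in `W = W_1`) and §7.1 Prop. 19] [cite: MazurRubinSilverberg2007, Def. 1.1 and Prop. 4.1] -/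
theorem stabilizerAction_blocks {t₀ : T} {α : stabilizer G t₀ →* End b.pt} {n : stabilizer G t₀ → Matrix κ κ ℤ}
    (hρ : ∀ (g : G) (u t : T) (i j : κ),
      b.ι j ≫ (c.ι t ≫ End.asHom (ρ g) ≫ c.π u) ≫ b.π i = A g u t i j • End.asHom (β g))
    (hα : ∀ h : stabilizer G t₀, End.asHom (α h) = c.ι t₀ ≫ End.asHom (ρ h) ≫ c.π t₀)
    (hn : ∀ h : stabilizer G t₀, n h = A h t₀ t₀) (h : stabilizer G t₀) (i j : κ) :
    b.ι j ≫ End.asHom (α h) ≫ b.π i = n h i j • End.asHom (β h) := by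
  rw [hα h, hn h]
  exact hρ h t₀ t₀ i j

omit [Fintype κ] [Fintype T] [DecidableEq κ] in
/-- Untwisted form: with inner blocks `A(g)_{u,t,ij} • 𝟙_Y` the stabiliser action has blocks `ι_j α(h) π_i = n(h)_{ij} • 𝟙_Y` — the
hypothesis `hρ₁` of `Motives/AbelianVarietyLatticeTensor` for `(b, n, α)`. [cite: SerreLinearRepresentations1977, §3.3 and §7.1 Prop. 19]
[cite: MazurRubinSilverberg2007, Def. 1.1 and Prop. 4.1] -/
theorem stabilizerAction_blocks_one {t₀ : T} {α : stabilizer G t₀ →* End b.pt} {n : stabilizer G t₀ → Matrix κ κ ℤ}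
    (hρ₁ : ∀ (g : G) (u t : T) (i j : κ), b.ι j ≫ (c.ι t ≫ End.asHom (ρ g) ≫ c.π u) ≫ b.π i = A g u t i j • 𝟙 Y)
    (hα : ∀ h : stabilizer G t₀, End.asHom (α h) = c.ι t₀ ≫ End.asHom (ρ h) ≫ c.π t₀)
    (hn : ∀ h : stabilizer G t₀, n h = A h t₀ t₀) (h : stabilizer G t₀) (i j : κ) :
    b.ι j ≫ End.asHom (α h) ≫ b.π i = n h i j • 𝟙 Y := by
  rw [hα h, hn h]
  exact hρ₁ h t₀ t₀ i j

end Imprimitive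

/-! ## §2 Dimension, character, fixed part and isotypical components of `Y ⊗ Ind_H^G N` -/

section Invariants

variable {Y : AbelianVariety K} {κ T : Type} [Fintype κ] [Fintype T] [DecidableEq κ] [DecidableEq T]
  (b : Bicone (fun _ : κ ↦ Y)) (c : Bicone (fun _ : T ↦ b.pt)) {G : Type} [Group G] [Fintype G] [MulAction G T]
  [IsPretransitive G T] (A : G → T → T → Matrix κ κ ℤ) (ρ : G →* End c.pt) (t₀ : T)
  (α : stabilizer G t₀ →* End b.pt) (n : stabilizer G t₀ →* Matrix κ κ ℤ)

omit [DecidableEq κ] [DecidableEq T] [Fintype G] in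
/-- **`dim (Y ⊗ Ind_H^G N) = [G : H] · |κ| · dim Y`** (`= rank(Ind N) · dim Y`, MRS Thm. 2.1 (i); `T` transitive, `H = Stab(t₀)`).
[cite: MazurRubinSilverberg2007, Thm. 2.1 (i)] [cite: SerreLinearRepresentations1977, §3.3 Definition (ii) (`dim V = (G : H) dim W`)] -/
theorem dim_twoLevel_eq_index_mul (hb : ∑ j, b.π j ≫ b.ι j = 𝟙 b.pt) (hc : ∑ t, c.π t ≫ c.ι t = 𝟙 c.pt) :
    c.pt.dim = (stabilizer G t₀).index * (Fintype.card κ * Y.dim) := by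
  rw [Imprimitive.dim_eq_index_stabilizer_mul (G := G) c hc t₀, dim_permPower_eq_card_mul b hb]

omit [DecidableEq κ] in
/-- **Serre's Theorem 12 for `Y ⊗ Ind_H^G N`** (`ℓ` invertible in `K`, untwisted inner level): **`|H| · Tr(ρ(g) | T_ℓ(Y ⊗ Ind N)) =
Σ_{x ∈ G, (x⁻¹gx) t₀ = t₀} tr A(x⁻¹ g x)_{t₀,t₀} · 2 dim Y`** — the induced character `|H|⁻¹ Σ_{x⁻¹gx ∈ H} χ_N(x⁻¹gx)` times `2 dim Y`
(the tree's Thm. 12 for the imprimitive system of §1, and `Tr(F | T_ℓ Y^κ) = tr(P) · 2 dim Y` for the scalar-block maps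
`ι_{t₀} ρ(y) π_{t₀}`). [cite: SerreLinearRepresentations1977, §3.3 Thm. 12] [cite: MazurRubinSilverberg2007, Thm. 2.2 (iii)] [cite: MumfordAV1970, §19 Thm. 4 (p. 180)] -/
theorem card_stabilizer_mul_trace_tateModuleMap_asHom_eq_sum (ℓ : ℕ) [Fact ℓ.Prime] (hb : ∑ j, b.π j ≫ b.ι j = 𝟙 b.pt)
    (hc : ∑ t, c.π t ≫ c.ι t = 𝟙 c.pt)
    (hρ₁ : ∀ (g : G) (u t : T) (i j : κ), b.ι j ≫ (c.ι t ≫ End.asHom (ρ g) ≫ c.π u) ≫ b.π i = A g u t i j • 𝟙 Y)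
    (hA : ∀ (g : G) (u t : T), g • t ≠ u → A g u t = 0) (hℓ : (ℓ : K) ≠ 0) (g : G) :
    (Nat.card (stabilizer G t₀) : ℤ_[ℓ]) * LinearMap.trace ℤ_[ℓ] (c.pt.tateModule ℓ) (tateModuleMap ℓ (End.asHom (ρ g))) =
      ∑ x : G, if (x⁻¹ * g * x) • t₀ = t₀ then ((A (x⁻¹ * g * x) t₀ t₀).trace : ℤ_[ℓ]) * ((2 * Y.dim : ℕ) : ℤ_[ℓ]) else 0 := by
  rw [Imprimitive.card_stabilizer_mul_trace_tateModuleMap_asHom_eq_sum ℓ c ρ hc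
    (imprimitive_of_blockMonomial b c A 1 ρ hb (fun g u t i j ↦ by rw [hρ₁ g u t i j]; rfl) hA) hℓ t₀ g]
  refine Finset.sum_congr rfl fun x _ ↦ ?_
  split_ifs with hx
  · rw [trace_tateModuleMap_eq_trace_mul_of_blocks ℓ b hb hℓ (hρ₁ (x⁻¹ * g * x) t₀ t₀),
      trace_tateModuleMap_id_eq_two_mul_dim ℓ Y hℓ]
  · rfl

/-- **`|H| · dim B_G(Y ⊗ Ind_H^G N) = (Σ_{h ∈ H} tr n(h)) · dim Y`** over ANY field (`T` transitive, `H = Stab(t₀)`, untwisted inner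
level, `B_G = Im Σ_g ρ(g)`, `n(h) = A(h)_{t₀,t₀}`): `dim B_G(Y ⊗ Ind N) = dim B_H(Y ⊗ N)` ("`(Ind_H^G W)^G ≅ W^H`", the tree's
`dim_image_normG_eq_dim_image_norm_stabilizer`) `= |H|⁻¹ (Σ_h tr n(h)) dim Y = rank(N^H) · dim Y` (the prequel).
[cite: SerreLinearRepresentations1977, §7.2 Thm. 13 and §2.3] [cite: MazurRubinSilverberg2007, Thm. 2.1 (i) and Prop. 4.1]
[cite: LangeRodriguez2022, §2.9.1 Prop. 2.9.3 (PDF p. 46)] [cite: KaniRosen1989, §3 Thm. B] -/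
theorem card_stabilizer_mul_dim_image_normG_eq (hb : ∑ j, b.π j ≫ b.ι j = 𝟙 b.pt) (hc : ∑ t, c.π t ≫ c.ι t = 𝟙 c.pt)
    (hρ₁ : ∀ (g : G) (u t : T) (i j : κ), b.ι j ≫ (c.ι t ≫ End.asHom (ρ g) ≫ c.π u) ≫ b.π i = A g u t i j • 𝟙 Y)
    (hA : ∀ (g : G) (u t : T), g • t ≠ u → A g u t = 0)
    (hα : ∀ h : stabilizer G t₀, End.asHom (α h) = c.ι t₀ ≫ End.asHom (ρ h) ≫ c.π t₀)
    (hn : ∀ h : stabilizer G t₀, n h = A h t₀ t₀) {NG : c.pt ⟶ c.pt} (hNG : End.of NG = ∑ g, ρ g) :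
    ((Fintype.card (stabilizer G t₀) * (image NG).dim : ℕ) : ℤ) = (∑ h : stabilizer G t₀, (n h).trace) * Y.dim := by
  have hρI := imprimitive_of_blockMonomial b c A 1 ρ hb (fun g u t i j ↦ by rw [hρ₁ g u t i j]; rfl) hA
  rw [Imprimitive.dim_image_normG_eq_dim_image_norm_stabilizer c ρ t₀ α hc hρI hα hNG (NH := End.asHom (∑ h, α h)) rfl]
  exact card_mul_dim_image_normG_eq b n α hb (stabilizerAction_blocks_one b c A ρ hρ₁ hα hn) rfl

variable {a : ratCharIdempotents G → G → ℤ}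
  (ha : ∀ e : ratCharIdempotents G,
    (Fintype.card G : ℚ) • (e : MonoidAlgebra ℚ G) = ∑ g, (a e g : ℚ) • MonoidAlgebra.of ℚ G g)
  {u : ratCharIdempotents G → (c.pt ⟶ c.pt)} (hu : ∀ e, End.of (u e) = ∑ g, a e g • ρ g)

include ha hu

/-- **`|H| · dim B_W(Y ⊗ Ind_H^G N) = (Σ_{h ∈ H} c_W(h) tr n(h)) · dim Y`** over ANY field, for every isotypical component
`B_W = Im u_W`, `u_W = Σ_g c_W(g) ρ(g)` (`T` transitive, `H = Stab(t₀)`, untwisted inner level): the tree's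
`|H| · 2 dim B_W(Ind Y₀) = Σ_{h ∈ H} c_W(h) χ_{Y₀}(h)` for the imprimitive system of §1 with `χ_{Y ⊗ N}(h) = tr n(h) · 2 dim Y` —
Frobenius reciprocity `⟨e_W, Ind_H^G χ_N⟩_G = ⟨Res_H e_W, χ_N⟩_H` times `dim Y`. [cite: LangeRodriguez2022, §2.9.1 Prop. 2.9.3 (PDF p. 46)]
[cite: SerreLinearRepresentations1977, §7.2 Thm. 13 and §3.3 Thm. 12] [cite: MazurRubinSilverberg2007, Def. 4.3 and Thm. 4.5] -/
theorem card_stabilizer_mul_dim_isotypical_eq (hb : ∑ j, b.π j ≫ b.ι j = 𝟙 b.pt) (hc : ∑ t, c.π t ≫ c.ι t = 𝟙 c.pt)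
    (hρ₁ : ∀ (g : G) (u t : T) (i j : κ), b.ι j ≫ (c.ι t ≫ End.asHom (ρ g) ≫ c.π u) ≫ b.π i = A g u t i j • 𝟙 Y)
    (hA : ∀ (g : G) (u t : T), g • t ≠ u → A g u t = 0)
    (hα : ∀ h : stabilizer G t₀, End.asHom (α h) = c.ι t₀ ≫ End.asHom (ρ h) ≫ c.π t₀)
    (hn : ∀ h : stabilizer G t₀, n h = A h t₀ t₀) (e : ratCharIdempotents G) :
    ((Fintype.card (stabilizer G t₀) * (image (u e)).dim : ℕ) : ℤ) =
      (∑ h : stabilizer G t₀, a e h * (n h).trace) * Y.dim := by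
  obtain ⟨ℓ, hℓp, hℓ⟩ := exists_prime_natCast_ne_zero (K := K)
  haveI : Fact ℓ.Prime := ⟨hℓp⟩
  have hρI := imprimitive_of_blockMonomial b c A 1 ρ hb (fun g u t i j ↦ by rw [hρ₁ g u t i j]; rfl) hA
  have hαb := stabilizerAction_blocks_one b c A ρ hρ₁ hα hn
  have key := Imprimitive.card_stabilizer_mul_two_mul_dim_isotypical_eq_sum ℓ c ρ t₀ α ha hu hc hρI hℓ hα e
  simp_rw [trace_tateModuleMap_asHom_eq_trace_mul_dim ℓ b n α hb hαb hℓ] at key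
  push_cast at key
  simp_rw [← mul_assoc] at key
  rw [← Finset.sum_mul, ← Finset.sum_mul] at key
  have key' : (((Fintype.card (stabilizer G t₀) * (image (u e)).dim : ℕ) : ℤ) : ℤ_[ℓ]) * 2 =
      ((((∑ h : stabilizer G t₀, a e h * (n h).trace) * Y.dim : ℤ)) : ℤ_[ℓ]) * 2 := by
    push_cast
    linear_combination key
  exact_mod_cast (mul_left_injective₀ (two_ne_zero' ℤ_[ℓ]) key' : _)

end Invariants

/-! ## §3 Flat monomial lattices are monomial actions (`κ = 1`): `Y ⊗ Ind_H^G ℤ(ε) = Ind_H^G(ε ⊗ Y)` -/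

section Monomial

variable {Y : AbelianVariety K} {T : Type} [Fintype T] [DecidableEq T] (b : Bicone (fun _ : T ↦ Y))
  {G : Type} [Group G] [MulAction G T] (m : G →* Matrix T T ℤ) (β : G →* End Y) (ρ : G →* End b.pt)

omit [Fintype T] [DecidableEq T] in
/-- **A lattice tensor with MONOMIAL matrices over a `G`-set is a system of imprimitivity with summand `Y`**: if `m(g)_{u,t} = 0`
unless `u = g t` (a monomial representation `Ind_H^G ℤ(ε)` in its natural basis), then `g t ≠ u ⇒ ι_t ≫ ρ(g) ≫ π_u = 0` — the
hypothesis `hρ` of `Motives/AbelianVarietyInducedAction` / `Motives/AbelianVarietyMonomialAction` for `(b, ρ)` (the rank-one case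
`κ = 1` of §1, without the two-level detour). [cite: SerreLinearRepresentations1977, §3.3 and §7.1 (monomial representations)]
[cite: MazurRubinSilverberg2007, Prop. 4.1] -/
theorem imprimitive_of_monomial {m : G → Matrix T T ℤ}
    (hρ : ∀ (g : G) (u t : T), b.ι t ≫ End.asHom (ρ g) ≫ b.π u = m g u t • End.asHom (β g))
    (hm : ∀ (g : G) (u t : T), g • t ≠ u → m g u t = 0) (g : G) (t u : T) (htu : g • t ≠ u) :
    b.ι t ≫ End.asHom (ρ g) ≫ b.π u = 0 := by
  rw [hρ g u t, hm g u t htu, zero_smul]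

/-- **The diagonal entry at `t₀` is a character of the stabiliser**: for a monomial integral representation (`m(g)_{u,t} = 0` unless
`u = g t`) and `H = Stab(t₀)` there is **`ε : H → ℤˣ` with `ε(h) = m(h)_{t₀t₀}`** (`m(hh')_{t₀t₀} = m(h)_{t₀t₀} m(h')_{t₀t₀}` since the
other terms of the matrix product vanish, and `m(h)_{t₀t₀} m(h⁻¹)_{t₀t₀} = 1`) — the character `ε` with `M = Ind_H^G ℤ(ε)`.
[cite: SerreLinearRepresentations1977, §7.1 (monomial representations: induced from a degree-one representation of `H`)] -/
theorem exists_stabilizerChar_of_monomial (hm : ∀ (g : G) (u t : T), g • t ≠ u → m g u t = 0) (t₀ : T) :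
    ∃ ε : stabilizer G t₀ →* ℤˣ, ∀ h : stabilizer G t₀, (ε h : ℤ) = m h t₀ t₀ := by
  -- the diagonal entry is multiplicative on the stabiliser
  have hmul : ∀ (g : G) (h : stabilizer G t₀), m (g * h) t₀ t₀ = m g t₀ t₀ * m h t₀ t₀ := by
    intro g h
    rw [map_mul, Matrix.mul_apply, Finset.sum_eq_single t₀]
    · intro u _ hu
      rw [hm (h : G) u t₀ (by rw [h.2]; exact Ne.symm hu), mul_zero]
    · intro h0
      exact absurd (Finset.mem_univ t₀) h0
  have hone : m 1 t₀ t₀ = 1 := by rw [map_one, Matrix.one_apply_eq]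
  have hinv : ∀ h : stabilizer G t₀, m h t₀ t₀ * m (h⁻¹ : stabilizer G t₀) t₀ t₀ = 1 := by
    intro h
    rw [← hmul (h : G) h⁻¹, Subgroup.coe_inv, mul_inv_cancel, hone]
  refine ⟨{ toFun := fun h ↦ Units.mkOfMulEqOne _ _ (hinv h)
            map_one' := Units.ext (by simp [hone])
            map_mul' := fun h h' ↦ Units.ext ?_ }, fun h ↦ rfl⟩
  simp only [Units.val_mkOfMulEqOne, Units.val_mul, Subgroup.coe_mul]
  exact hmul (h : G) h'

omit [Fintype T] [DecidableEq T] in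
/-- **Flat monomial lattices are the monomial actions `Ind_H^G(ε ⊗ Y)` of `Motives/AbelianVarietyMonomialAction`** (untwisted tensor):
with `ε(h) = m(h)_{t₀t₀}` the transfer at `t₀` is **`ι_{t₀} ≫ ρ(h) ≫ π_{t₀} = ε(h) • 𝟙_Y`** for `h ∈ Stab(t₀)` — together with
`imprimitive_of_monomial` exactly the defining hypotheses of that file, whose characters, `dim B_G`, isotypical multiplicities and
decompositions therefore apply to `Y ⊗ Ind_H^G ℤ(ε)`. [cite: SerreLinearRepresentations1977, §7.1 (monomial representations) and §3.3 Thm. 12]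
[cite: MazurRubinSilverberg2007, Def. 1.1 and Prop. 4.1] -/
theorem transfer_eq_units_smul_of_monomial {m : G → Matrix T T ℤ}
    (hρ₁ : ∀ (g : G) (u t : T), b.ι t ≫ End.asHom (ρ g) ≫ b.π u = m g u t • 𝟙 Y) {t₀ : T}
    {ε : stabilizer G t₀ →* ℤˣ} (hε : ∀ h : stabilizer G t₀, (ε h : ℤ) = m h t₀ t₀) (h : stabilizer G t₀) :
    b.ι t₀ ≫ End.asHom (ρ h) ≫ b.π t₀ = (ε h : ℤ) • 𝟙 Y := by
  rw [hρ₁, hε]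

end Monomial

end LatticeTensor

end AbelianVariety

end Literature.AlgebraicGeometry.Motives
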